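import Literature.NumberTheory.Automorphic.QuaternionSplitMatrixModel
import Literature.NumberTheory.Automorphic.MatrixTwoConjugacy
import Literature.NumberTheory.Automorphic.QuaternionCoordOrderAdelicLiftProofs
import HarnessLib

/-!
# Split local places: conjugating a norm-one quaternion of nearby trace next to a given one

Topic `NumberTheory/Automorphic`; theorems only (no definition, no named fact). A local input of
Kneser's strong approximation theorem for `ℍ[K,a,b]¹` in Vignéras's proof (LNM 800, Ch. III §4,
proof of Thm. 4.3, p. 81: *"Comme `t` est une application ouverte … Deux éléments de même trace
réduite et de même norme réduite sont conjugués (I.2.1)"*), at a finite place `w` where the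
algebra **splits** (`ℍ[K_w,α,β] ≃ M₂(K_w)`, `β = s² - α t²`, `QuaternionSplitMatrixModel`):

* `exists_forall_det_one_trace_add` : the trace is an **open map on `SL₂(K_w)`**, quantitatively —
  next to any `m ∈ SL₂(K_w)` (entrywise, to any prescribed precision `r`) there are elements of
  `SL₂(K_w)` of every trace `tr m + ε`, `|ε| ≤ ρ` (explicit perturbations of two entries);
* `exists_center_forall_det_one_trace_eq` : the same with a centre `c` (close to `tr m`) such that
  *all* traces `t'` with `|t' - c| ≤ ρ` occur and avoid `±2`;
* `exists_center_forall_conj_near_of_split` : **for `g ∈ ℍ[K_w,α,β]¹` and a precision `r` there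
  are `c ∈ K_w`, `ρ > 0` such that every `y ∈ ℍ[K_w,α,β]¹` whose reduced trace `2 y₀` satisfies
  `|2 y₀ - c| ≤ ρ` is conjugate, by a unit of `ℍ[K_w,α,β]`, to an element all of whose coordinates
  differ from those of `g` by elements of valuation `≤ r`** (the element of the first step has the
  trace and norm of `y` and is not central as its trace is `≠ ±2`; conjugacy of non-scalar `2 × 2`
  matrices with the same characteristic polynomial, `MatrixTwoConjugacy`).

## References

* M.-F. Vignéras, *Arithmétique des algèbres de quaternions*, LNM 800 (1980), Ch. I §2 Thm. 2.1
  (Cor.: éléments de mêmes trace et norme réduites), Ch. III §4, proof of Thm. 4.3 [VignerasLNM800].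
-/

noncomputable section

open scoped Quaternion WithZero
open NumberField IsDedekindDomain

namespace Literature.NumberTheory.Automorphic

variable (K : Type) [Field K] [NumberField K] (v : HeightOneSpectrum (𝓞 K))

/-- `K_v`. -/
local notation "Kᵥ" => HeightOneSpectrum.adicCompletion K v

/-! ### Small elements of `K_v` -/

/-- For every non-zero `r` in the value group there is a non-zero `η ∈ K_v` with `|η| < r`
(powers of a uniformiser). [folklore] -/
theorem exists_ne_zero_valued_lt {r : ℤᵐ⁰} (hr : r ≠ 0) : ∃ η : Kᵥ, η ≠ 0 ∧ Valued.v η < r := by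
  obtain ⟨π, hπ⟩ := v.valuation_exists_uniformizer K
  have hπv : Valued.v (algebraMap K Kᵥ π) = WithZero.exp (-1 : ℤ) := by
    rw [← hπ]
    exact HeightOneSpectrum.valuedAdicCompletion_eq_valuation' v π
  have hπ0 : (algebraMap K Kᵥ π) ≠ 0 := fun h => by
    rw [h, map_zero] at hπv
    exact WithZero.exp_ne_zero hπv.symm
  -- `r = exp m`; take `η = π^n` with `-n < m`
  set m : ℤ := WithZero.log r with hm
  refine ⟨algebraMap K Kᵥ π ^ ((-m).toNat + 1), pow_ne_zero _ hπ0, ?_⟩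
  rw [map_pow, hπv, ← WithZero.exp_nsmul, ← WithZero.exp_log hr, WithZero.exp_lt_exp, ← hm,
    smul_neg, nsmul_eq_mul, mul_one]
  have h := Int.self_le_toNat (-m)
  push_cast
  omega

/-- For every non-zero `r` there is a non-zero `η ∈ K_v` with `|η| ≤ r`. [folklore] -/
theorem exists_ne_zero_valued_le {r : ℤᵐ⁰} (hr : r ≠ 0) : ∃ η : Kᵥ, η ≠ 0 ∧ Valued.v η ≤ r := by
  obtain ⟨η, hη0, hη⟩ := exists_ne_zero_valued_lt K v hr
  exact ⟨η, hη0, hη.le⟩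

/-- Bookkeeping: given a non-zero pivot `p` and a coefficient `c`, for `|ε| ≤ ρ` (some `ρ > 0`,
`ρ ≤ r`) one has `|ε c / p| ≤ r`. [folklore] -/
theorem exists_forall_valued_mul_mul_inv_le {p : Kᵥ} (hp : p ≠ 0) (c : Kᵥ) {r : ℤᵐ⁰} (hr : r ≠ 0) :
    ∃ ρ : ℤᵐ⁰, ρ ≠ 0 ∧ ρ ≤ r ∧ ∀ ε : Kᵥ, Valued.v ε ≤ ρ → Valued.v (ε * c * p⁻¹) ≤ r := by
  set M : ℤᵐ⁰ := max (Valued.v c) 1 with hM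
  have hM0 : M ≠ 0 := (lt_of_lt_of_le zero_lt_one (le_max_right _ _)).ne'
  have hvp : Valued.v p ≠ 0 := (Valuation.ne_zero_iff _).mpr hp
  refine ⟨min r (r * Valued.v p * M⁻¹), (lt_min (zero_lt_iff.mpr hr) (zero_lt_iff.mpr
    (mul_ne_zero (mul_ne_zero hr hvp) (inv_ne_zero hM0)))).ne', min_le_left _ _, fun ε hε => ?_⟩
  have hε' : Valued.v ε ≤ r * Valued.v p * M⁻¹ := hε.trans (min_le_right _ _)
  have hc : Valued.v c ≤ M := le_max_left _ _
  calc Valued.v (ε * c * p⁻¹) = Valued.v ε * Valued.v c * (Valued.v p)⁻¹ := by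
        rw [map_mul, map_mul, map_inv₀]
    _ ≤ r * Valued.v p * M⁻¹ * M * (Valued.v p)⁻¹ := by gcongr
    _ = r := by rw [inv_mul_cancel_right₀ hM0, mul_inv_cancel_right₀ hvp]

/-! ### The trace is open on `SL₂(K_v)` -/

/-- **The trace is an open map on `SL₂(K_v)`, quantitatively**: for `m ∈ SL₂(K_v)` and a precision
`r ≠ 0` there is `ρ ≠ 0` such that for every `ε` with `|ε| ≤ ρ` some `m' ∈ SL₂(K_v)` has trace
`tr m + ε` and all its entries within `r` of those of `m` (perturb the entry `m₀₀` by `ε` and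
compensate in `m₁₀`, `m₀₁`, or — for diagonal `m` — in both off-diagonal entries).
[cite: VignerasLNM800, Ch. III §4 (proof of Thm. 4.3: "t est une application ouverte")] -/
theorem exists_forall_det_one_trace_add (m : Matrix (Fin 2) (Fin 2) Kᵥ) (hm : m.det = 1)
    {r : ℤᵐ⁰} (hr : r ≠ 0) :
    ∃ ρ : ℤᵐ⁰, ρ ≠ 0 ∧ ∀ ε : Kᵥ, Valued.v ε ≤ ρ →
      ∃ m' : Matrix (Fin 2) (Fin 2) Kᵥ, m'.det = 1 ∧ m'.trace = m.trace + ε ∧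
        ∀ i j, Valued.v (m' i j - m i j) ≤ r := by
  have hdet : m 0 0 * m 1 1 - m 0 1 * m 1 0 = 1 := by rw [← Matrix.det_fin_two]; exact hm
  by_cases hq : m 0 1 = 0
  · by_cases hp : m 1 0 = 0
    · -- diagonal `m`: `m' = [m₀₀ + ε, η; ε m₁₁ / η, m₁₁]` with a fixed small `η ≠ 0`
      obtain ⟨η, hη0, hηr⟩ := exists_ne_zero_valued_le K v hr
      obtain ⟨ρ, hρ0, hρr, hρ⟩ := exists_forall_valued_mul_mul_inv_le K v hη0 (m 1 1) hr
      have hinv : η * η⁻¹ = 1 := mul_inv_cancel₀ hη0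
      refine ⟨ρ, hρ0, fun ε hε => ⟨!![m 0 0 + ε, η; ε * m 1 1 * η⁻¹, m 1 1], ?_, ?_, ?_⟩⟩
      · rw [Matrix.det_fin_two_of]
        linear_combination hdet + m 1 0 * hq - ε * m 1 1 * hinv
      · rw [Matrix.trace_fin_two_of, Matrix.trace_fin_two]
        ring
      · intro i j
        fin_cases i <;> fin_cases j
        · simpa using hε.trans hρr
        · simpa [hq] using hηr
        · simpa [hp] using hρ ε hε
        · simp
    · -- `m₁₀ ≠ 0`: `m' = [m₀₀ + ε, m₀₁ + ε m₁₁ / m₁₀; m₁₀, m₁₁]`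
      obtain ⟨ρ, hρ0, hρr, hρ⟩ := exists_forall_valued_mul_mul_inv_le K v hp (m 1 1) hr
      have hinv : m 1 0 * (m 1 0)⁻¹ = 1 := mul_inv_cancel₀ hp
      refine ⟨ρ, hρ0, fun ε hε => ⟨!![m 0 0 + ε, m 0 1 + ε * m 1 1 * (m 1 0)⁻¹; m 1 0, m 1 1],
        ?_, ?_, ?_⟩⟩
      · rw [Matrix.det_fin_two_of]
        linear_combination hdet - ε * m 1 1 * hinv
      · rw [Matrix.trace_fin_two_of, Matrix.trace_fin_two]
        ring
      · intro i j
        fin_cases i <;> fin_cases j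
        · simpa using hε.trans hρr
        · simpa using hρ ε hε
        · simp
        · simp
  · -- `m₀₁ ≠ 0`: `m' = [m₀₀ + ε, m₀₁; m₁₀ + ε m₁₁ / m₀₁, m₁₁]`
    obtain ⟨ρ, hρ0, hρr, hρ⟩ := exists_forall_valued_mul_mul_inv_le K v hq (m 1 1) hr
    have hinv : m 0 1 * (m 0 1)⁻¹ = 1 := mul_inv_cancel₀ hq
    refine ⟨ρ, hρ0, fun ε hε => ⟨!![m 0 0 + ε, m 0 1; m 1 0 + ε * m 1 1 * (m 0 1)⁻¹, m 1 1],
      ?_, ?_, ?_⟩⟩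
    · rw [Matrix.det_fin_two_of]
      linear_combination hdet - ε * m 1 1 * hinv
    · rw [Matrix.trace_fin_two_of, Matrix.trace_fin_two]
      ring
    · intro i j
      fin_cases i <;> fin_cases j
      · simpa using hε.trans hρr
      · simp
      · simpa using hρ ε hε
      · simp

/-- The same with a **centre**: there are `c ∈ K_v` and `ρ ≠ 0` such that every `t'` with
`|t' - c| ≤ ρ` is `≠ ±2` and is the trace of some `m' ∈ SL₂(K_v)` entrywise within `r` of `m`
(`c = tr m + η` with `η ≠ 0` smaller than the `ρ` of `exists_forall_det_one_trace_add` and than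
`|±2 - tr m|` when these are non-zero; `ρ < |η|`, so that `|t' - tr m| = |η|` exactly). [folklore] -/
theorem exists_center_forall_det_one_trace_eq (m : Matrix (Fin 2) (Fin 2) Kᵥ) (hm : m.det = 1)
    {r : ℤᵐ⁰} (hr : r ≠ 0) :
    ∃ (c : Kᵥ) (ρ : ℤᵐ⁰), ρ ≠ 0 ∧ ∀ t' : Kᵥ, Valued.v (t' - c) ≤ ρ →
      t' ≠ 2 ∧ t' ≠ -2 ∧ ∃ m' : Matrix (Fin 2) (Fin 2) Kᵥ, m'.det = 1 ∧ m'.trace = t' ∧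
        ∀ i j, Valued.v (m' i j - m i j) ≤ r := by
  obtain ⟨ρ₀, hρ₀, hm'⟩ := exists_forall_det_one_trace_add K v m hm hr
  -- the bound for `η`
  set d₁ : ℤᵐ⁰ := Valued.v (2 - m.trace) with hd₁
  set d₂ : ℤᵐ⁰ := Valued.v (-2 - m.trace) with hd₂
  set B : ℤᵐ⁰ := min ρ₀ (min (if d₁ = 0 then ρ₀ else d₁) (if d₂ = 0 then ρ₀ else d₂)) with hB
  have hB0 : B ≠ 0 := by
    refine (lt_min (zero_lt_iff.mpr hρ₀) (lt_min ?_ ?_)).ne' <;> split_ifs with h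
    · exact zero_lt_iff.mpr hρ₀
    · exact zero_lt_iff.mpr h
    · exact zero_lt_iff.mpr hρ₀
    · exact zero_lt_iff.mpr h
  obtain ⟨η, hη0, hηB⟩ := exists_ne_zero_valued_lt K v hB0
  have hvη : Valued.v η ≠ 0 := (Valuation.ne_zero_iff _).mpr hη0
  obtain ⟨η₂, hη₂0, hη₂⟩ := exists_ne_zero_valued_lt K v hvη
  refine ⟨m.trace + η, Valued.v η₂, (Valuation.ne_zero_iff _).mpr hη₂0, fun t' ht' => ?_⟩
  -- `ε = t' - tr m` has `|ε| = |η|`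
  have hε : t' - m.trace = η + (t' - (m.trace + η)) := by ring
  have hvε : Valued.v (t' - m.trace) = Valued.v η := by
    rw [hε]
    exact Valuation.map_add_eq_of_lt_left _ (lt_of_le_of_lt ht' hη₂)
  have hεB : Valued.v (t' - m.trace) < B := hvε ▸ hηB
  have hne : ∀ x : Kᵥ, Valued.v (x - m.trace) ≠ 0 → B ≤ Valued.v (x - m.trace) → t' ≠ x := by
    intro x _ hBx htx
    rw [htx] at hεB
    exact (lt_irrefl _) (lt_of_lt_of_le hεB hBx)
  have hne' : ∀ x : Kᵥ, Valued.v (x - m.trace) = 0 → t' ≠ x := by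
    intro x hx htx
    rw [htx, hx] at hvε
    exact hvη hvε.symm
  refine ⟨?_, ?_, ?_⟩
  · by_cases h : d₁ = 0
    · exact hne' 2 h
    · refine hne 2 h ((min_le_right _ _).trans ((min_le_left _ _).trans ?_))
      rw [if_neg h]
  · by_cases h : d₂ = 0
    · exact hne' (-2) h
    · refine hne (-2) h ((min_le_right _ _).trans ((min_le_right _ _).trans ?_))
      rw [if_neg h]
  · obtain ⟨m', hm'1, hm'2, hm'3⟩ := hm' (t' - m.trace) (hεB.le.trans (min_le_left _ _))
    exact ⟨m', hm'1, by rw [hm'2]; ring, hm'3⟩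

/-! ### Transport to `ℍ[K_v,α,β]` -/

namespace QuaternionAlgebra

variable {K v}

/-- `ψ⁻¹` is additive: `splitSection (m' - m) = splitSection m' - splitSection m`. [folklore] -/
theorem splitSection_sub {α β s t : Kᵥ} (hδ : IsUnit (2 * α * β))
    (m' m : Matrix (Fin 2) (Fin 2) Kᵥ) :
    splitSection s t hδ (m' - m) =
      (splitSection s t hδ m' : ℍ[Kᵥ,α,β]) - splitSection s t hδ m := by
  ext <;> simp only [splitSection_re, splitSection_imI, splitSection_imJ, splitSection_imK,
    _root_.QuaternionAlgebra.re_sub, _root_.QuaternionAlgebra.imI_sub,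
    _root_.QuaternionAlgebra.imJ_sub, _root_.QuaternionAlgebra.imK_sub, Matrix.sub_apply] <;> ring

/-- **Entrywise-small matrices have coordinatewise-small `ψ⁻¹`**: for `r ≠ 0` there is `r' ≠ 0`
such that `|d i j| ≤ r'` for all `i, j` forces all four coordinates of `splitSection d` to have
valuation `≤ r` (the coordinates are fixed linear forms in the entries; ultrametric inequality).
[folklore] -/
theorem exists_forall_splitSection_le {α β s t : Kᵥ} (hδ : IsUnit (2 * α * β)) {r : ℤᵐ⁰}
    (hr : r ≠ 0) :
    ∃ r' : ℤᵐ⁰, r' ≠ 0 ∧ ∀ d : Matrix (Fin 2) (Fin 2) Kᵥ, (∀ i j, Valued.v (d i j) ≤ r') →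
      Valued.v (splitSection s t hδ d).re ≤ r ∧ Valued.v (splitSection s t hδ d).imI ≤ r ∧
      Valued.v (splitSection s t hδ d).imJ ≤ r ∧ Valued.v (splitSection s t hδ d).imK ≤ r := by
  -- a common bound `C ≥ 1` for the valuations of the coefficients
  set A : ℤᵐ⁰ := max 1 (Valued.v α) with hA
  set C : ℤᵐ⁰ := max 1 (Valued.v (((hδ.unit⁻¹ : Kᵥˣ) : Kᵥ)) *
    (max (Valued.v α * Valued.v β) (max (Valued.v β * A)
      (max (Valued.v α * max (Valued.v s) (Valued.v t * A)) (max (Valued.v s * A) (Valued.v α * Valued.v t)))))) with hC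
  have hC1 : 1 ≤ C := le_max_left _ _
  have hC0 : C ≠ 0 := (lt_of_lt_of_le zero_lt_one hC1).ne'
  refine ⟨r * C⁻¹, mul_ne_zero hr (inv_ne_zero hC0), fun d hd => ?_⟩
  set r' := r * C⁻¹ with hr'
  set u : Kᵥ := ((hδ.unit⁻¹ : Kᵥˣ) : Kᵥ) with hu
  -- `|coefficient| * r' ≤ r` for each of the four coordinate bounds
  have key : ∀ c : ℤᵐ⁰, Valued.v u * c ≤ C → Valued.v u * c * r' ≤ r := fun c hc => by
    calc Valued.v u * c * r' ≤ C * r' := by gcongr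
      _ = r := by rw [hr', mul_comm r, ← mul_assoc, mul_inv_cancel₀ hC0, one_mul]
  have hcoef : ∀ c : ℤᵐ⁰, c ≤ max (Valued.v α * Valued.v β) (max (Valued.v β * A)
      (max (Valued.v α * max (Valued.v s) (Valued.v t * A))
        (max (Valued.v s * A) (Valued.v α * Valued.v t)))) → Valued.v u * c ≤ C := fun c hc =>
    (mul_le_mul' le_rfl hc).trans (le_max_right _ _)
  have hA1 : (1 : ℤᵐ⁰) ≤ A := le_max_left _ _
  have hAα : Valued.v α ≤ A := le_max_right _ _
  -- entry bounds
  have h00 := hd 0 0; have h01 := hd 0 1; have h10 := hd 1 0; have h11 := hd 1 1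
  have hsum : Valued.v (d 0 0 + d 1 1) ≤ r' := Valuation.map_add_le _ h00 h11
  have hdiff : Valued.v (d 0 0 - d 1 1) ≤ r' := Valuation.map_sub_le _ h00 h11
  have hmixI : Valued.v (d 0 1 + α * d 1 0) ≤ A * r' := by
    refine Valuation.map_add_le _ (h01.trans ?_) ?_
    · exact le_mul_of_one_le_left' hA1
    · rw [map_mul]; exact mul_le_mul' hAα h10
  have hmixK : Valued.v (α * d 1 0 - d 0 1) ≤ A * r' := by
    refine Valuation.map_sub_le _ ?_ (h01.trans ?_)
    · rw [map_mul]; exact mul_le_mul' hAα h10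
    · exact le_mul_of_one_le_left' hA1
  refine ⟨?_, ?_, ?_, ?_⟩
  · rw [splitSection_re, map_mul, map_mul, map_mul]
    calc Valued.v u * (Valued.v α * Valued.v β * Valued.v (d 0 0 + d 1 1))
        ≤ Valued.v u * (Valued.v α * Valued.v β) * r' := by
          rw [mul_assoc (Valued.v u)]; gcongr
      _ ≤ r := key _ (hcoef _ (le_max_left _ _))
  · rw [splitSection_imI, map_mul, map_mul]
    calc Valued.v u * (Valued.v β * Valued.v (d 0 1 + α * d 1 0))
        ≤ Valued.v u * (Valued.v β * A) * r' := by
          rw [mul_assoc (Valued.v u), mul_assoc (Valued.v β)]; gcongr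
      _ ≤ r := key _ (hcoef _ ((le_max_left _ _).trans (le_max_right _ _)))
  · rw [splitSection_imJ, map_mul, map_mul]
    have hin : Valued.v (s * (d 0 0 - d 1 1) - t * (α * d 1 0 - d 0 1)) ≤
        max (Valued.v s) (Valued.v t * A) * r' := by
      refine Valuation.map_sub_le _ ?_ ?_
      · rw [map_mul]
        exact mul_le_mul' (le_max_left _ _) hdiff
      · rw [map_mul]
        calc Valued.v t * Valued.v (α * d 1 0 - d 0 1) ≤ Valued.v t * (A * r') :=
              mul_le_mul' le_rfl hmixK
          _ = Valued.v t * A * r' := by rw [mul_assoc]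
          _ ≤ max (Valued.v s) (Valued.v t * A) * r' := by gcongr; exact le_max_right _ _
    calc Valued.v u * (Valued.v α * Valued.v (s * (d 0 0 - d 1 1) - t * (α * d 1 0 - d 0 1)))
        ≤ Valued.v u * (Valued.v α * max (Valued.v s) (Valued.v t * A)) * r' := by
          rw [mul_assoc (Valued.v u), mul_assoc (Valued.v α)]; gcongr
      _ ≤ r := key _ (hcoef _ ((le_max_left _ _).trans ((le_max_right _ _).trans
          (le_max_right _ _))))
  · rw [splitSection_imK, map_mul]
    have hin : Valued.v (s * (α * d 1 0 - d 0 1) - α * t * (d 0 0 - d 1 1)) ≤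
        max (Valued.v s * A) (Valued.v α * Valued.v t) * r' := by
      refine Valuation.map_sub_le _ ?_ ?_
      · rw [map_mul]
        calc Valued.v s * Valued.v (α * d 1 0 - d 0 1) ≤ Valued.v s * (A * r') :=
              mul_le_mul' le_rfl hmixK
          _ = Valued.v s * A * r' := by rw [mul_assoc]
          _ ≤ max (Valued.v s * A) (Valued.v α * Valued.v t) * r' := by
              gcongr; exact le_max_left _ _
      · rw [map_mul, map_mul]
        calc Valued.v α * Valued.v t * Valued.v (d 0 0 - d 1 1)
            ≤ Valued.v α * Valued.v t * r' := mul_le_mul' le_rfl hdiff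
          _ ≤ max (Valued.v s * A) (Valued.v α * Valued.v t) * r' := by
              gcongr; exact le_max_right _ _
    calc Valued.v u * Valued.v (s * (α * d 1 0 - d 0 1) - α * t * (d 0 0 - d 1 1))
        ≤ Valued.v u * max (Valued.v s * A) (Valued.v α * Valued.v t) * r' := by
          rw [mul_assoc (Valued.v u)]; gcongr
      _ ≤ r := key _ (hcoef _ ((le_max_right _ _).trans ((le_max_right _ _).trans
          (le_max_right _ _))))

/-- A matrix of determinant `1` and trace `≠ ±2` is not scalar. [folklore] -/
theorem not_mem_bot_of_det_eq_one {F : Type*} [Field F] {A : Matrix (Fin 2) (Fin 2) F}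
    (hdet : A.det = 1) (h2 : A.trace ≠ 2) (h2' : A.trace ≠ -2) :
    A ∉ (⊥ : Subalgebra F (Matrix (Fin 2) (Fin 2) F)) := by
  intro hA
  rw [Algebra.mem_bot, Set.mem_range] at hA
  obtain ⟨c, rfl⟩ := hA
  rw [Matrix.algebraMap_eq_diagonal, Matrix.det_diagonal, Fin.prod_univ_two,
    Pi.algebraMap_apply, Pi.algebraMap_apply, Algebra.algebraMap_self_apply] at hdet
  rw [Matrix.algebraMap_eq_diagonal, Matrix.trace_diagonal, Fin.sum_univ_two,
    Pi.algebraMap_apply, Pi.algebraMap_apply, Algebra.algebraMap_self_apply] at h2 h2'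
  have hc : (c - 1) * (c + 1) = 0 := by linear_combination hdet
  rcases mul_eq_zero.mp hc with h | h
  · exact h2 (by linear_combination 2 * h)
  · exact h2' (by linear_combination 2 * h)

/-- The trace of `ψ(q)` is the reduced trace `2 q₀`. [folklore] -/
theorem trace_splitHom {α β s t : Kᵥ} (hst : s ^ 2 - α * t ^ 2 = β) (q : ℍ[Kᵥ,α,β]) :
    (splitHom α β s t hst q).trace = 2 * q.re := by
  rw [splitHom_apply, splitLin_apply, Matrix.trace_fin_two_of]
  simp only [Matrix.cons_val_zero, Matrix.cons_val]
  ring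

/-- **Split local places: conjugating norm-one elements of nearby trace next to a given one.**
Let `ℍ[K_v,α,β]` be split (`β = s² - α t²`, `α β ≠ 0`), `g ∈ ℍ[K_v,α,β]` with `g ḡ = 1`, and
`r ≠ 0`. There are `c ∈ K_v` and `ρ ≠ 0` such that every `y` with `y ȳ = 1` and reduced trace
`2 y₀` within `ρ` of `c` is conjugate under `ℍ[K_v,α,β]^×` to an element whose four coordinates
differ from those of `g` by elements of valuation `≤ r` (Vignéras III §4, proof of Thm. 4.3:
"`t` est une application ouverte" and "deux éléments de même trace réduite et de même norme
réduite sont conjugués"). [cite: VignerasLNM800, Ch. III §4 (proof of Thm. 4.3) and Ch. I §2 Thm. 2.1] -/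
theorem exists_center_forall_conj_near_of_split {α β s t : Kᵥ} (hα : α ≠ 0) (hβ : β ≠ 0)
    (hst : s ^ 2 - α * t ^ 2 = β) (g : ℍ[Kᵥ,α,β]) (hg : g * star g = 1) {r : ℤᵐ⁰} (hr : r ≠ 0) :
    ∃ (c : Kᵥ) (ρ : ℤᵐ⁰), ρ ≠ 0 ∧ ∀ y : ℍ[Kᵥ,α,β], y * star y = 1 →
      Valued.v (2 * y.re - c) ≤ ρ →
      ∃ x : (ℍ[Kᵥ,α,β])ˣ,
        Valued.v ((x : ℍ[Kᵥ,α,β]) * y * ((x⁻¹ : (ℍ[Kᵥ,α,β])ˣ) : ℍ[Kᵥ,α,β]) - g).re ≤ r ∧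
        Valued.v ((x : ℍ[Kᵥ,α,β]) * y * ((x⁻¹ : (ℍ[Kᵥ,α,β])ˣ) : ℍ[Kᵥ,α,β]) - g).imI ≤ r ∧
        Valued.v ((x : ℍ[Kᵥ,α,β]) * y * ((x⁻¹ : (ℍ[Kᵥ,α,β])ˣ) : ℍ[Kᵥ,α,β]) - g).imJ ≤ r ∧
        Valued.v ((x : ℍ[Kᵥ,α,β]) * y * ((x⁻¹ : (ℍ[Kᵥ,α,β])ˣ) : ℍ[Kᵥ,α,β]) - g).imK ≤ r := by
  haveI : CharZero Kᵥ := charZero_of_injective_algebraMap (algebraMap K Kᵥ).injective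
  have hδ : IsUnit (2 * α * β) :=
    isUnit_iff_ne_zero.mpr (mul_ne_zero (mul_ne_zero two_ne_zero hα) hβ)
  set ψ := splitEquiv hst hδ with hψ
  -- `m = ψ(g) ∈ SL₂(K_v)`
  have hdetg : (splitHom α β s t hst g).det = 1 := by
    rw [det_splitHom, ← mul_star_eq_one_iff_coords]; exact hg
  obtain ⟨r', hr'0, hr'⟩ := exists_forall_splitSection_le (s := s) (t := t) hδ hr
  obtain ⟨c, ρ, hρ0, hc⟩ := exists_center_forall_det_one_trace_eq K v _ hdetg hr'0
  refine ⟨c, ρ, hρ0, fun y hy hyc => ?_⟩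
  obtain ⟨h2, h2', m', hm'1, hm'2, hm'3⟩ := hc (2 * y.re) hyc
  -- `ψ(y)` and `m'` are non-scalar with the same trace and determinant: conjugate
  have hdety : (splitHom α β s t hst y).det = 1 := by
    rw [det_splitHom, ← mul_star_eq_one_iff_coords]; exact hy
  have htry : (splitHom α β s t hst y).trace = 2 * y.re := trace_splitHom hst y
  have hy' : splitHom α β s t hst y ∉ (⊥ : Subalgebra Kᵥ (Matrix (Fin 2) (Fin 2) Kᵥ)) :=
    not_mem_bot_of_det_eq_one hdety (htry ▸ h2) (htry ▸ h2')
  have hm'' : m' ∉ (⊥ : Subalgebra Kᵥ (Matrix (Fin 2) (Fin 2) Kᵥ)) :=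
    not_mem_bot_of_det_eq_one hm'1 (hm'2 ▸ h2) (hm'2 ▸ h2')
  obtain ⟨P, hP⟩ := exists_units_conj_eq_of_trace_eq_of_det_eq hy' hm''
    (by rw [htry, hm'2]) (by rw [hdety, hm'1])
  -- pull the conjugator back to `ℍ[K_v,α,β]`
  set x : (ℍ[Kᵥ,α,β])ˣ := Units.map (ψ.symm : Matrix (Fin 2) (Fin 2) Kᵥ ≃ₐ[Kᵥ] ℍ[Kᵥ,α,β]).toMonoidHom P
    with hx
  refine ⟨x, ?_⟩
  have hconj : (x : ℍ[Kᵥ,α,β]) * y * ((x⁻¹ : (ℍ[Kᵥ,α,β])ˣ) : ℍ[Kᵥ,α,β]) = ψ.symm m' := by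
    have hyψ : y = ψ.symm (splitHom α β s t hst y) := by
      rw [← splitEquiv_apply hst hδ, ← hψ, AlgEquiv.symm_apply_apply]
    have hP1 : (x : ℍ[Kᵥ,α,β]) = ψ.symm (P : Matrix (Fin 2) (Fin 2) Kᵥ) := rfl
    have hP2 : ((x⁻¹ : (ℍ[Kᵥ,α,β])ˣ) : ℍ[Kᵥ,α,β]) =
        ψ.symm ((P⁻¹ : GL (Fin 2) Kᵥ) : Matrix (Fin 2) (Fin 2) Kᵥ) := rfl
    rw [hP1, hP2, hyψ, ← map_mul, ← map_mul, hP]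
  have hdiff : ψ.symm m' - g = splitSection s t hδ (m' - splitHom α β s t hst g) := by
    rw [splitSection_sub, hψ, splitEquiv_symm_apply, ← splitEquiv_symm_apply hst hδ
      (splitHom α β s t hst g), ← splitEquiv_apply hst hδ, AlgEquiv.symm_apply_apply]
  rw [hconj, hdiff]
  exact hr' _ hm'3

end QuaternionAlgebra

end Literature.NumberTheory.Automorphic
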